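import Mathlib
import Summits.ValiantsHypothesis.ValiantsHypothesis.Theorems.RigidityForcesSymmetryRankRigidMinimalReprLaplaceContractCheap
import Summits.ValiantsHypothesis.ValiantsHypothesis.Theorems.RigidityForcesSymmetryRankRigidMinimalReprLaplaceFiveTwoSlicesNormalize

/-!
# `LaplaceOptimalFive`: a decomposition of weight `< 72` is five sorted pair terms on a `2`-regular multigraph
# (crux `RankRigidMinimalRepr`, stmt-ValiantsHypothesis-18034; frontier rung `LaplaceOptimalFive`, stmt-24813)

The format-level half of the rung `72 ≤ weight` of the frontier item `LaplaceOptimal 5` (stmt-24813).  In the OFFICIAL data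
format (split-rank-one terms `u_t(v|_{S_t}) · w_t(v|_{S_tᶜ})` summing to `[v injective]` on `Fin 5 → Fin 5`), a decomposition
of Laplace weight `< 72` consists of slices (weight `24`) and pair terms (weight `12`) with `2·#slices + #pairs ≤ 5`, and the five
slot-contraction inequalities `LaplaceContract.laplace_five_slot_contraction` (p8 g11: `24 ≤ Σ c_t!(4-c_t)!` over the terms that are
not slices at `s`) then force: NO slice (at the slot of a slice at most three other terms survive, each counting `≤ 6`), EXACTLY
five pair terms, and every slot on the `2`-slot side of exactly two of them (`24 ≤ 4·5 + 2·deg(s)` and `Σ_s deg(s) = 10`).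
`cheap72_pairs` packages this as five oriented, lexicographically sorted pair cuts `p t < q t` with `deg ≡ 2`, in the local pair
format of `LaplaceFiveSlices` (val-width-24813-w1 g1's `pair_sort`).

HONEST FRAMING: bookkeeping toward the rung `72 ≤ weight` of `LaplaceOptimalFive` (stmt-24813), which stays OPEN; nothing here
bears on the crux or on `VP ≠ VNP`, which is NOT proved.
-/

set_option autoImplicit false

-- the mandated summit-side namespace repeats a component by design (single-problem summit)
set_option linter.dupNamespace false

namespace Summit.ValiantsHypothesis.ValiantsHypothesis.Theorems.RigidityForcesSymmetryRankRigidMinimalRepr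

namespace LaplaceFivePairCore

open Finset

/-! ### §1 The contraction summands and the pair normal form with its `2`-slot side -/

/-- The slot-contraction summand `c!(4-c)!`, `c = |S| - [s ∈ S]`, of a slice or pair term that is not a slice at `s` is `≤ 6`. -/
theorem contraction_summand_le_six : ∀ (s : Fin 5) (S : Finset (Fin 5)),
    (S.card = 1 ∨ S.card = 4 ∨ S.card = 2 ∨ S.card = 3) → ¬ (S = {s} ∨ S = {s}ᶜ) →
    (S.card - (if s ∈ S then 1 else 0)).factorial * (4 - (S.card - (if s ∈ S then 1 else 0))).factorial ≤ 6 := by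
  decide

/-- The slot-contraction summand of a PAIR term: `6` if `s` lies on the `2`-slot side, `4` otherwise. -/
theorem contraction_summand_pair : ∀ (s : Fin 5) (S : Finset (Fin 5)), (S.card = 2 ∨ S.card = 3) →
    (S.card - (if s ∈ S then 1 else 0)).factorial * (4 - (S.card - (if s ∈ S then 1 else 0))).factorial =
      if s ∈ (if S.card = 2 then S else Sᶜ) then 6 else 4 := by
  decide

/-- A pair term (`|S| = 2` or `|S| = 3`) is `u'(v_p, v_q) · w'(v)` with `w'` blind to `p, q`, where `{p, q}` is the `2`-slot side. -/
theorem pair_normal_form_two (S : Finset (Fin 5)) (u w : (Fin 5 → Fin 5) → ℂ)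
    (hu : ∀ v v' : Fin 5 → Fin 5, (∀ i ∈ S, v i = v' i) → u v = u v')
    (hw : ∀ v v' : Fin 5 → Fin 5, (∀ i, i ∉ S → v i = v' i) → w v = w v')
    (h : S.card = 2 ∨ S.card = 3) :
    ∃ (p q : Fin 5) (u' w' : (Fin 5 → Fin 5) → ℂ), p ≠ q ∧ (if S.card = 2 then S else Sᶜ) = {p, q} ∧
      (∀ v v' : Fin 5 → Fin 5, v p = v' p → v q = v' q → u' v = u' v') ∧
      (∀ v v' : Fin 5 → Fin 5, (∀ j, j ≠ p → j ≠ q → v j = v' j) → w' v = w' v') ∧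
      ∀ v, u v * w v = u' v * w' v := by
  classical
  rcases h with h | h
  · obtain ⟨p, q, hpq, hS⟩ := card_eq_two.mp h
    refine ⟨p, q, u, w, hpq, by rw [if_pos h, hS], fun v v' hp hq => hu v v' (fun i hi => ?_),
      fun v v' hvv' => hw v v' (fun i hi => hvv' i ?_ ?_), fun v => rfl⟩
    · rw [hS, mem_insert, mem_singleton] at hi
      rcases hi with rfl | rfl
      · exact hp
      · exact hq
    · rintro rfl; exact hi (by rw [hS]; simp)
    · rintro rfl; exact hi (by rw [hS]; simp)
  · have hc : Sᶜ.card = 2 := by rw [card_compl, h]; rfl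
    obtain ⟨p, q, hpq, hS⟩ := card_eq_two.mp hc
    have hp : p ∉ S := by rw [← mem_compl, hS]; simp
    have hq : q ∉ S := by rw [← mem_compl, hS]; simp
    have h2 : ¬ S.card = 2 := by rw [h]; decide
    refine ⟨p, q, w, u, hpq, by rw [if_neg h2, hS], fun v v' hvp hvq => hw v v' (fun i hi => ?_),
      fun v v' hvv' => hu v v' (fun i hi => hvv' i ?_ ?_), fun v => mul_comm _ _⟩
    · have : i ∈ Sᶜ := mem_compl.mpr hi
      rw [hS, mem_insert, mem_singleton] at this
      rcases this with rfl | rfl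
      · exact hvp
      · exact hvq
    · rintro rfl; exact hp hi
    · rintro rfl; exact hq hi

/-- The `2`-slot side of a pair term has two elements. -/
theorem two_side_card' (S : Finset (Fin 5)) (h : S.card = 2 ∨ S.card = 3) : (if S.card = 2 then S else Sᶜ).card = 2 := by
  rcases h with h | h
  · rw [if_pos h, h]
  · have h2 : ¬ S.card = 2 := by rw [h]; decide
    rw [if_neg h2, card_compl, h]; rfl

/-! ### §2 Weight `< 72`: five sorted pair terms on a `2`-regular multigraph -/

/-- **Weight `< 72` ⇒ five sorted oriented pair cuts, each slot of degree two.**  In the data format of `LaplaceOptimal 5`: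
if the terms sum to `[v injective]` with total Laplace weight `< 72`, then the pattern is a sum of five pair terms
`u_t(v) · w_t(v)` — `u_t` a function of `(v_{p t}, v_{q t})`, `w_t` blind to `p t, q t` — with `p t < q t`, the cuts in
lexicographically non-decreasing order, and every slot an endpoint of exactly two cuts. -/
theorem cheap72_pairs {N : ℕ} (T : Finset (Fin N)) (S : Fin N → Finset (Fin 5))
    (u w : Fin N → (Fin 5 → Fin 5) → ℂ)
    (hu : ∀ t, ∀ v v' : Fin 5 → Fin 5, (∀ i ∈ S t, v i = v' i) → u t v = u t v')
    (hw : ∀ t, ∀ v v' : Fin 5 → Fin 5, (∀ i, i ∉ S t → v i = v' i) → w t v = w t v')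
    (hsum : ∀ v : Fin 5 → Fin 5, (∑ t ∈ T, u t v * w t v) = if Function.Injective v then 1 else 0)
    (hlt : ∑ t ∈ T, (S t).card.factorial * (5 - (S t).card).factorial < 72) :
    ∃ (p q : Fin 5 → Fin 5) (u' w' : Fin 5 → (Fin 5 → Fin 5) → ℂ),
      (∀ t, p t < q t) ∧
      (∀ t t' : Fin 5, t < t' → p t < p t' ∨ (p t = p t' ∧ q t ≤ q t')) ∧
      (∀ s : Fin 5, (∑ t : Fin 5, if (p t = s ∨ q t = s) then (1 : ℕ) else 0) = 2) ∧
      (∀ t, ∀ v v' : Fin 5 → Fin 5, v (p t) = v' (p t) → v (q t) = v' (q t) → u' t v = u' t v') ∧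
      (∀ t, ∀ v v' : Fin 5 → Fin 5, (∀ j, j ≠ p t → j ≠ q t → v j = v' j) → w' t v = w' t v') ∧
      ∀ v : Fin 5 → Fin 5, (if Function.Injective v then (1 : ℂ) else 0) = ∑ t, u' t v * w' t v := by
  classical
  have hlt120 : ∑ t ∈ T, (S t).card.factorial * (5 - (S t).card).factorial < 120 := lt_trans hlt (by norm_num)
  -- every term is a slice or a pair term (weight of a single term < 72)
  have hwt : ∀ t ∈ T, (S t).card.factorial * (5 - (S t).card).factorial < 72 := fun t ht =>
    lt_of_le_of_lt (single_le_sum (f := fun t => (S t).card.factorial * (5 - (S t).card).factorial)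
      (fun _ _ => Nat.zero_le _) ht) hlt
  have hcard5 : ∀ t, (S t).card ≤ 5 := fun t => (card_le_univ _).trans (by simp)
  have htype : ∀ t ∈ T, ((S t).card = 1 ∨ (S t).card = 4) ∨ ((S t).card = 2 ∨ (S t).card = 3) := by
    intro t ht
    have h1 := hwt t ht
    have h2 := hcard5 t
    interval_cases hc : (S t).card <;> simp_all (config := {decide := true})
  set Sl := T.filter (fun t => (S t).card = 1 ∨ (S t).card = 4) with hSl
  set Pr := T.filter (fun t => (S t).card = 2 ∨ (S t).card = 3) with hPr
  have hdisj : Disjoint Sl Pr := by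
    rw [hSl, hPr, disjoint_filter]; intro t _ h1 h2; omega
  have hunion : T = Sl ∪ Pr := by
    ext t
    simp only [hSl, hPr, mem_union, mem_filter]
    constructor
    · intro ht; rcases htype t ht with h | h
      · exact Or.inl ⟨ht, h⟩
      · exact Or.inr ⟨ht, h⟩
    · rintro (⟨ht, -⟩ | ⟨ht, -⟩) <;> exact ht
  -- the weight: 24 |Sl| + 12 |Pr| < 72
  have hweight : 24 * Sl.card + 12 * Pr.card < 72 := by
    have e1 : ∑ t ∈ Sl, (S t).card.factorial * (5 - (S t).card).factorial = 24 * Sl.card := by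
      rw [mul_comm, ← smul_eq_mul, ← sum_const]
      refine sum_congr rfl fun t ht => ?_
      rw [hSl, mem_filter] at ht
      rcases ht.2 with h | h <;> rw [h] <;> decide
    have e2 : ∑ t ∈ Pr, (S t).card.factorial * (5 - (S t).card).factorial = 12 * Pr.card := by
      rw [mul_comm, ← smul_eq_mul, ← sum_const]
      refine sum_congr rfl fun t ht => ?_
      rw [hPr, mem_filter] at ht
      rcases ht.2 with h | h <;> rw [h] <;> decide
    rw [hunion, sum_union hdisj, e1, e2] at hlt
    exact hlt
  have hTcard : T.card = Sl.card + Pr.card := by rw [hunion, card_union_of_disjoint hdisj]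
  -- (A) there is no slice: at its slot at most three other terms survive the contraction, each counting `≤ 6`
  have hSl0 : Sl = ∅ := by
    by_contra hne
    obtain ⟨t₀, ht₀⟩ := nonempty_iff_ne_empty.mpr hne
    have ht₀T : t₀ ∈ T := (mem_filter.mp ht₀).1
    obtain ⟨s₀, hs₀⟩ : ∃ s₀, S t₀ = {s₀} ∨ S t₀ = {s₀}ᶜ := by
      rcases (mem_filter.mp ht₀).2 with h | h
      · obtain ⟨s₀, hs⟩ := card_eq_one.mp h; exact ⟨s₀, Or.inl hs⟩
      · have hc : (S t₀)ᶜ.card = 1 := by rw [card_compl, h]; rfl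
        obtain ⟨s₀, hs⟩ := card_eq_one.mp hc
        exact ⟨s₀, Or.inr (by rw [← compl_compl (S t₀), hs])⟩
    have hcon := LaplaceContract.laplace_five_slot_contraction T S u w hu hw hsum hlt120 s₀
    set F := T.filter (fun t => ¬ (S t = {s₀} ∨ S t = {s₀}ᶜ)) with hF
    have hle6 : (∑ t ∈ F, ((S t).card - (if s₀ ∈ S t then 1 else 0)).factorial *
        (4 - ((S t).card - (if s₀ ∈ S t then 1 else 0))).factorial) ≤ 6 * F.card := by
      rw [mul_comm, ← smul_eq_mul, ← sum_const]
      refine sum_le_sum fun t ht => ?_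
      obtain ⟨htT, hnot⟩ := mem_filter.mp ht
      exact contraction_summand_le_six s₀ (S t) (by rcases htype t htT with (h|h)|(h|h) <;> simp [h]) hnot
    have hFcard : F.card ≤ T.card - 1 := by
      have hsub : F ⊆ T.erase t₀ := by
        intro t ht
        obtain ⟨htT, hnot⟩ := mem_filter.mp ht
        refine mem_erase.mpr ⟨?_, htT⟩
        rintro rfl; exact hnot hs₀
      exact (card_le_card hsub).trans (by rw [card_erase_of_mem ht₀T])
    have hSl1 : 1 ≤ Sl.card := card_pos.mpr ⟨t₀, ht₀⟩
    omega
  -- (B) all terms are pair terms; the contraction inequalities in degree form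
  have hTPr : T = Pr := by rw [hunion, hSl0, empty_union]
  have hPr5 : Pr.card ≤ 5 := by omega
  have hD : ∀ s : Fin 5, 24 ≤ 4 * Pr.card + 2 * (Pr.filter (fun t => s ∈ (if (S t).card = 2 then S t else (S t)ᶜ))).card := by
    intro s
    have hcon := LaplaceContract.laplace_five_slot_contraction T S u w hu hw hsum hlt120 s
    have hfilt : T.filter (fun t => ¬ (S t = {s} ∨ S t = {s}ᶜ)) = Pr := by
      rw [hTPr]
      refine filter_true_of_mem fun t ht => ?_
      obtain ⟨-, hc⟩ := mem_filter.mp ht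
      rintro (h | h)
      · rw [h, card_singleton] at hc; omega
      · rw [h, card_compl, card_singleton, Fintype.card_fin] at hc; omega
    rw [hfilt] at hcon
    have hsum6 : (∑ t ∈ Pr, ((S t).card - (if s ∈ S t then 1 else 0)).factorial *
        (4 - ((S t).card - (if s ∈ S t then 1 else 0))).factorial) =
        ∑ t ∈ Pr, (if s ∈ (if (S t).card = 2 then S t else (S t)ᶜ) then 6 else 4) :=
      sum_congr rfl fun t ht => contraction_summand_pair s (S t) (mem_filter.mp ht).2
    rw [hsum6, ← sum_filter_add_sum_filter_not Pr (fun t => s ∈ (if (S t).card = 2 then S t else (S t)ᶜ))] at hcon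
    rw [sum_congr rfl (fun t ht => if_pos (mem_filter.mp ht).2),
      sum_congr rfl (fun t ht => if_neg (mem_filter.mp ht).2)] at hcon
    simp only [sum_const, smul_eq_mul] at hcon
    have := card_filter_add_card_filter_not (s := Pr)
      (fun t => s ∈ (if (S t).card = 2 then S t else (S t)ᶜ))
    omega
  -- `Σ_s deg(s) = 2 |Pr|`
  have hDsum : (∑ s : Fin 5, (Pr.filter (fun t => s ∈ (if (S t).card = 2 then S t else (S t)ᶜ))).card) = 2 * Pr.card := by
    simp only [card_filter]
    rw [sum_comm, mul_comm, ← smul_eq_mul, ← sum_const]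
    refine sum_congr rfl fun t ht => ?_
    rw [← card_filter, filter_mem_eq_inter, univ_inter]
    exact two_side_card' (S t) (mem_filter.mp ht).2
  -- hence `|Pr| = 5` and every degree is `2`
  have hPr5' : Pr.card = 5 := by
    have h := sum_le_sum (s := (univ : Finset (Fin 5))) (fun s _ => hD s)
    simp only [sum_const, card_univ, Fintype.card_fin, smul_eq_mul, sum_add_distrib, ← mul_sum] at h
    omega
  have hDge : ∀ s : Fin 5, 2 ≤ (Pr.filter (fun t => s ∈ (if (S t).card = 2 then S t else (S t)ᶜ))).card := by
    intro s; have := hD s; omega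
  have hDeq : ∀ s : Fin 5, (Pr.filter (fun t => s ∈ (if (S t).card = 2 then S t else (S t)ᶜ))).card = 2 := by
    intro s
    have h1 := add_sum_erase (univ : Finset (Fin 5))
      (fun s => (Pr.filter (fun t => s ∈ (if (S t).card = 2 then S t else (S t)ᶜ))).card) (mem_univ s)
    have h2 := card_nsmul_le_sum (univ.erase s)
      (fun s => (Pr.filter (fun t => s ∈ (if (S t).card = 2 then S t else (S t)ᶜ))).card) 2 (fun s' _ => hDge s')
    rw [card_erase_of_mem (mem_univ s), card_univ, Fintype.card_fin] at h2
    simp only [smul_eq_mul] at h2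
    have h3 := hDge s
    omega
  -- (C) normal forms of the five pair terms
  have keyP : ∀ x : Pr, ∃ (p q : Fin 5) (u' w' : (Fin 5 → Fin 5) → ℂ), p ≠ q ∧
      (if (S x).card = 2 then S x else (S x)ᶜ) = {p, q} ∧
      (∀ v v' : Fin 5 → Fin 5, v p = v' p → v q = v' q → u' v = u' v') ∧
      (∀ v v' : Fin 5 → Fin 5, (∀ j, j ≠ p → j ≠ q → v j = v' j) → w' v = w' v') ∧
      ∀ v, u x v * w x v = u' v * w' v := fun x =>
    pair_normal_form_two (S x) (u x) (w x) (hu x) (hw x) (by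
      have hx : (x : Fin N) ∈ T.filter (fun t => (S t).card = 2 ∨ (S t).card = 3) := x.2
      exact (mem_filter.mp hx).2)
  choose pp qq uu ww hpq htwo huu hww hpterm using keyP
  have hcardPr : Fintype.card Pr = 5 := by rw [Fintype.card_coe, hPr5']
  let eP : Pr ≃ Fin 5 := Fintype.equivFinOfCardEq hcardPr
  let P : Fin 5 → Fin 5 := fun t => pp (eP.symm t)
  let Q : Fin 5 → Fin 5 := fun t => qq (eP.symm t)
  let U : Fin 5 → (Fin 5 → Fin 5) → ℂ := fun t => uu (eP.symm t)
  let V : Fin 5 → (Fin 5 → Fin 5) → ℂ := fun t => ww (eP.symm t)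
  have hPQ : ∀ t, P t ≠ Q t := fun t => hpq _
  have H : ∀ v : Fin 5 → Fin 5, (if Function.Injective v then (1 : ℂ) else 0) = ∑ t, U t v * V t v := by
    intro v
    rw [← hsum v, hTPr, ← sum_coe_sort Pr]
    simp only [hpterm]
    exact Fintype.sum_equiv eP _ _ (fun x => by simp [U, V])
  have hdegPQ : ∀ s : Fin 5, (∑ t : Fin 5, if (P t = s ∨ Q t = s) then (1 : ℕ) else 0) = 2 := by
    intro s
    rw [← hDeq s, card_filter, ← sum_coe_sort Pr]
    refine (Fintype.sum_equiv eP.symm _ _ (fun t => ?_))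
    simp only [P, Q, htwo, mem_insert, mem_singleton]
    congr 1
    exact propext ⟨fun h => h.elim (fun h => Or.inl h.symm) (fun h => Or.inr h.symm),
      fun h => h.elim (fun h => Or.inl h.symm) (fun h => Or.inr h.symm)⟩
  -- (D) orient the cuts and sort them
  let p₁ : Fin 5 → Fin 5 := fun t => min (P t) (Q t)
  let q₁ : Fin 5 → Fin 5 := fun t => max (P t) (Q t)
  have hpq₁ : ∀ t, p₁ t < q₁ t := fun t => min_lt_max.mpr (hPQ t)
  have hpair₁ : ∀ t, ∀ v v' : Fin 5 → Fin 5, v (p₁ t) = v' (p₁ t) → v (q₁ t) = v' (q₁ t) →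
      v (P t) = v' (P t) ∧ v (Q t) = v' (Q t) := by
    intro t v v' h1 h2
    simp only [p₁, q₁] at h1 h2
    rcases le_total (P t) (Q t) with h | h
    · rw [min_eq_left h] at h1; rw [max_eq_right h] at h2; exact ⟨h1, h2⟩
    · rw [min_eq_right h] at h1; rw [max_eq_left h] at h2; exact ⟨h2, h1⟩
  have hoff₁ : ∀ t j, j ≠ p₁ t → j ≠ q₁ t → j ≠ P t ∧ j ≠ Q t := by
    intro t j h1 h2
    simp only [p₁, q₁] at h1 h2
    rcases le_total (P t) (Q t) with h | h
    · rw [min_eq_left h] at h1; rw [max_eq_right h] at h2; exact ⟨h1, h2⟩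
    · rw [min_eq_right h] at h1; rw [max_eq_left h] at h2; exact ⟨h2, h1⟩
  have hdeg₁ : ∀ s t, (p₁ t = s ∨ q₁ t = s) ↔ (P t = s ∨ Q t = s) := by
    intro s t
    simp only [p₁, q₁]
    rcases le_total (P t) (Q t) with h | h
    · rw [min_eq_left h, max_eq_right h]
    · rw [min_eq_right h, max_eq_left h]; exact Or.comm
  obtain ⟨κ, hκ⟩ := LaplaceFiveSlices.pair_sort p₁ q₁
  refine ⟨fun t => p₁ (κ t), fun t => q₁ (κ t), fun t v => U (κ t) v, fun t v => V (κ t) v,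
    fun t => hpq₁ (κ t), hκ, ?_, ?_, ?_, ?_⟩
  · -- degrees
    intro s
    rw [← hdegPQ s]
    rw [← Equiv.sum_comp κ (fun t => if (P t = s ∨ Q t = s) then (1 : ℕ) else 0)]
    refine Fintype.sum_congr _ _ (fun t => ?_)
    simp only [hdeg₁ s (κ t)]
  · -- `u'` depends on the two cut slots only
    intro t v v' h1 h2
    obtain ⟨e1, e2⟩ := hpair₁ (κ t) v v' h1 h2
    exact huu _ v v' e1 e2
  · -- `w'` blind to the two cut slots
    intro t v v' hvv'
    refine hww _ v v' (fun j hjP hjQ => ?_)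
    have hne : j ≠ p₁ (κ t) ∧ j ≠ q₁ (κ t) := by
      constructor
      · intro h; simp only [p₁] at h
        rcases le_total (P (κ t)) (Q (κ t)) with hle | hle
        · rw [min_eq_left hle] at h; exact hjP h
        · rw [min_eq_right hle] at h; exact hjQ h
      · intro h; simp only [q₁] at h
        rcases le_total (P (κ t)) (Q (κ t)) with hle | hle
        · rw [max_eq_right hle] at h; exact hjQ h
        · rw [max_eq_left hle] at h; exact hjP h
    exact hvv' j hne.1 hne.2
  · -- the identity
    intro v
    rw [H v]
    exact (Equiv.sum_comp κ (fun t => U t v * V t v)).symm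

end LaplaceFivePairCore

end Summit.ValiantsHypothesis.ValiantsHypothesis.Theorems.RigidityForcesSymmetryRankRigidMinimalRepr
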